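import Mathlib.Analysis.SpecialFunctions.Pow.Real
import HarnessLib

/-!
# Brinkman–Rice mass enhancement under pressure: the closed form fitted to κ-(BEDT-TTF)₂X quantum oscillations

[Erkenov2025KappaBEDTTTFMottThesis, §5.6 Eq. (5.2), Table 5.1; §7; §8.7] (with [OberbauerEtAl2023KappaClHeavyCarriers]
for the low-pressure part) fits the pressure dependence of the Shubnikov–de Haas cyclotron mass of the
magnetic-breakdown β orbit in κ-(BEDT-TTF)₂Cu[N(CN)₂]Cl, -Cu(NCS)₂, -Cu[N(CN)₂]Br and -Cu₂(CN)₃ with the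
Brinkman–Rice form `m*/m_band = [1 − (u/u₀)²]⁻¹` (`u = U/t`, `u₀` the critical ratio), taking `U` fixed and the
transfer integral LINEAR in pressure, `t(p) = t₀[1 + γ(p − p₀)]`, so that `u(p)/u₀ = 1/(1 + γ(p − p₀))` and

  `m_c/m_c,band (p) = (1 − 1/[1 + γ(p − p₀)]²)⁻¹`                                    (Eq. 5.2)

with printed fit parameters (β orbit): κ-Cl `m_band = 2.07 ± 0.1 m₀, p₀ = −0.28 ± 0.04 GPa, γ = 0.77 ± 0.11 GPa⁻¹`;
κ-NCS `1.9 ± 0.3, −0.29 ± 0.08, 0.63 ± 0.28`; κ-Br (γ fixed `0.8`) `2.2 ± 0.1, −0.30 ± 0.01`; κ-CN `2.8 ± 0.3,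
−0.16 ± 0.03, 0.8 ± 0.2` [Table 5.1 p. 72; p. 127; p. 144].

This file types that closed form and its exact consequences — nothing about whether Brinkman–Rice is the right
theory: with `s = 1 + γ(p − p₀)` the ratio is `s²/(s² − 1)` (`brMassRatio_eq_sq_div`); it exceeds `1` for `s > 1`
and is antitone in `s` (`one_lt_brMassRatio`, `brMassRatio_anti`); its inverse is LINEAR in `1/s²`,
`1 − (m_band/m_c) = 1/s²` (`one_sub_inv_brMassRatio`); near the critical pressure it is inverse-linear,
`1/(3(s−1)) ≤ m_c/m_band − 1 ≤ 1/(2(s−1))` for `1 < s ≤ 2` (`brMassRatio_sub_one_bounds`) — the «inverse-linear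
pressure dependence of the mass» of the low-pressure fit; it equals `2` exactly at `s² = 2`
(`brMassRatio_eq_two_iff`); far from `p₀` it returns to the band mass, e.g. `s ≥ 3 ⇒ m_c/m_band ≤ 9/8`
(`brMassRatio_le_of_three_le`).  The hopping dictionary `Δt/t₀ = γΔp` (`hopping_rel_change`) and the
correlation ratio `u(p) = u₀/s` (`corrRatio_div`) are spelled out, and the printed parameter sets are evaluated
exactly at the pressures the thesis discusses: κ-Cl ambient image `(3.09, 3.10)`, κ-NCS `(3.50, 3.51)`, κ-Br
`(2.86, 2.87)` — times the fitted band mass `2.2 m₀` this is `(6.29, 6.32) m₀`, the measured pulsed-field mass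
`6.3 ± 0.1 m₀` [p. 111] —, κ-CN at `0.24` GPa `(2.34, 2.35)` ⇒ `(6.5, 6.6) m₀` against the measured
`7.2 cos 24°` [p. 142–143], κ-Cl at `1.5` GPa `(1.21, 1.22)` («approaches the band mass»); and the two printed
theory-vs-experiment ratios of the pressure sensitivity, `0.77/0.07 = 11` («an order of magnitude») and
`0.8/0.23 ∈ (3.47, 3.48)` («three times») [p. 73; p. 144].

Everything is a definition with a body or a proved theorem; no named facts, no axioms beyond Mathlib's, no
`sorry`.  References: S. Erkenov, Dissertation, TU München (2025) (held: paper:galaxy-pdf-4600565880);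
S. Oberbauer et al., Phys. Rev. B 107 (2023) 075139; W. F. Brinkman, T. M. Rice, Phys. Rev. B 2 (1970) 4302.
AI-produced formalisation (H21, cell hubbard-downfold, seat lit-2, 2026-08-29); 0 facts.
-/

namespace Literature.MathematicalPhysics.QuantumLattice.BrinkmanRicePressure

/-! ## The dictionary: linear hopping, correlation ratio, Brinkman–Rice enhancement -/

/-- Transfer integral linear in pressure: `t(p) = t₀ (1 + γ (p − p₀))`.
[cite: Erkenov2025KappaBEDTTTFMottThesis, §5.6 p. 72] -/
noncomputable def hopping (t₀ γ p₀ p : ℝ) : ℝ := t₀ * (1 + γ * (p - p₀))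

/-- The reduced pressure variable `s = 1 + γ (p − p₀) = t(p)/t₀`.
[cite: Erkenov2025KappaBEDTTTFMottThesis, §5.6 p. 72] -/
noncomputable def sVar (γ p₀ p : ℝ) : ℝ := 1 + γ * (p - p₀)

/-- Correlation ratio at fixed `U`: `u(p) = (U/t)(p) = u₀ / (1 + γ (p − p₀))`, `u₀ = U/t₀` the Brinkman–Rice
critical ratio. [cite: Erkenov2025KappaBEDTTTFMottThesis, §5.6 p. 72] -/
noncomputable def corrRatio (u₀ γ p₀ p : ℝ) : ℝ := u₀ / (1 + γ * (p - p₀))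

/-- Brinkman–Rice enhancement as a function of the reduced ratio `x = u/u₀`: `(1 − x²)⁻¹`.
[cite: Erkenov2025KappaBEDTTTFMottThesis, §5.6 p. 72] -/
noncomputable def brEnhancement (x : ℝ) : ℝ := (1 - x ^ 2)⁻¹

/-- **Eq. (5.2)**: `m_c/m_c,band (p) = (1 − 1/[1 + γ(p − p₀)]²)⁻¹`.
[cite: Erkenov2025KappaBEDTTTFMottThesis, §5.6 Eq. (5.2) p. 72] -/
noncomputable def brMassRatio (γ p₀ p : ℝ) : ℝ := (1 - 1 / (1 + γ * (p - p₀)) ^ 2)⁻¹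

/-- Unfolding of `hopping`. [cite: Erkenov2025KappaBEDTTTFMottThesis, §5.6 p. 72] -/
theorem hopping_def (t₀ γ p₀ p : ℝ) : hopping t₀ γ p₀ p = t₀ * (1 + γ * (p - p₀)) := rfl

/-- Unfolding of `brMassRatio`. [cite: Erkenov2025KappaBEDTTTFMottThesis, §5.6 Eq. (5.2) p. 72] -/
theorem brMassRatio_def (γ p₀ p : ℝ) :
    brMassRatio γ p₀ p = (1 - 1 / (1 + γ * (p - p₀)) ^ 2)⁻¹ := rfl

/-- `t(p)/t₀ = s`. [cite: Erkenov2025KappaBEDTTTFMottThesis, §5.6 p. 72] -/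
theorem hopping_div (t₀ γ p₀ p : ℝ) (ht : t₀ ≠ 0) : hopping t₀ γ p₀ p / t₀ = sVar γ p₀ p := by
  simp only [hopping, sVar]; field_simp

/-- **`γ dp = dt/t₀`**: the relative change of the hopping between two pressures is `γ (p₂ − p₁)`.
[cite: Erkenov2025KappaBEDTTTFMottThesis, §5.6 p. 73] -/
theorem hopping_rel_change (t₀ γ p₀ p₁ p₂ : ℝ) (ht : t₀ ≠ 0) :
    (hopping t₀ γ p₀ p₂ - hopping t₀ γ p₀ p₁) / t₀ = γ * (p₂ - p₁) := by
  simp only [hopping]; field_simp; ring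

/-- `u(p) = u₀ / s`. [cite: Erkenov2025KappaBEDTTTFMottThesis, §5.6 p. 72] -/
theorem corrRatio_eq (u₀ γ p₀ p : ℝ) : corrRatio u₀ γ p₀ p = u₀ / sVar γ p₀ p := rfl

/-- `u(p)/u₀ = 1/s` (for `u₀ ≠ 0`). [cite: Erkenov2025KappaBEDTTTFMottThesis, §5.6 p. 72] -/
theorem corrRatio_div (u₀ γ p₀ p : ℝ) (hu : u₀ ≠ 0) (hs : sVar γ p₀ p ≠ 0) :
    corrRatio u₀ γ p₀ p / u₀ = 1 / sVar γ p₀ p := by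
  simp only [corrRatio, sVar] at *; field_simp

/-- **Eq. (5.2) is the Brinkman–Rice enhancement evaluated at `x = u(p)/u₀`.**
[cite: Erkenov2025KappaBEDTTTFMottThesis, §5.6 Eq. (5.2) p. 72] -/
theorem brMassRatio_eq_brEnhancement (u₀ γ p₀ p : ℝ) (hu : u₀ ≠ 0) (hs : sVar γ p₀ p ≠ 0) :
    brMassRatio γ p₀ p = brEnhancement (corrRatio u₀ γ p₀ p / u₀) := by
  rw [corrRatio_div u₀ γ p₀ p hu hs]
  simp only [brMassRatio, brEnhancement, sVar]
  congr 1; rw [div_pow, one_pow]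

/-! ## The closed form in the reduced variable `s` -/

/-- `m_c/m_band = s²/(s² − 1)`. [cite: Erkenov2025KappaBEDTTTFMottThesis, §5.6 Eq. (5.2) p. 72] -/
theorem brMassRatio_eq_sq_div (γ p₀ p : ℝ) (hs : sVar γ p₀ p ≠ 0) :
    brMassRatio γ p₀ p = sVar γ p₀ p ^ 2 / (sVar γ p₀ p ^ 2 - 1) := by
  simp only [brMassRatio, sVar] at *
  have h2 : (1 + γ * (p - p₀)) ^ 2 ≠ 0 := pow_ne_zero 2 hs
  have h3 : 1 - 1 / (1 + γ * (p - p₀)) ^ 2 = ((1 + γ * (p - p₀)) ^ 2 - 1) / (1 + γ * (p - p₀)) ^ 2 := by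
    field_simp
  rw [h3, inv_div]

/-- **The inverse mass is linear in `1/s²`**: `1 − (m_c/m_band)⁻¹ = 1/s²`.
[cite: Erkenov2025KappaBEDTTTFMottThesis, §5.6 p. 71] -/
theorem one_sub_inv_brMassRatio (γ p₀ p : ℝ) :
    1 - (brMassRatio γ p₀ p)⁻¹ = 1 / sVar γ p₀ p ^ 2 := by
  simp only [brMassRatio, sVar, inv_inv]; ring

/-- For `s > 1` the enhancement exceeds one: `1 < m_c/m_band`.
[cite: Erkenov2025KappaBEDTTTFMottThesis, §5.6 p. 72] -/
theorem one_lt_brMassRatio {γ p₀ p : ℝ} (hs : 1 < sVar γ p₀ p) :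
    1 < brMassRatio γ p₀ p := by
  have hs0 : sVar γ p₀ p ≠ 0 := by linarith
  rw [brMassRatio_eq_sq_div γ p₀ p hs0]
  have h1 : 1 < sVar γ p₀ p ^ 2 := by nlinarith
  rw [lt_div_iff₀ (by linarith)]; linarith

/-- `m_c/m_band − 1 = 1/(s² − 1)`. [cite: Erkenov2025KappaBEDTTTFMottThesis, §5.6 p. 72] -/
theorem brMassRatio_sub_one {γ p₀ p : ℝ} (hs : 1 < sVar γ p₀ p) :
    brMassRatio γ p₀ p - 1 = 1 / (sVar γ p₀ p ^ 2 - 1) := by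
  have hs0 : sVar γ p₀ p ≠ 0 := by linarith
  have h1 : sVar γ p₀ p ^ 2 - 1 ≠ 0 := by nlinarith
  rw [brMassRatio_eq_sq_div γ p₀ p hs0]; field_simp; ring

/-- **Inverse-linear divergence at the critical pressure**: for `1 < s ≤ 2` (i.e. `0 < γ(p − p₀) ≤ 1`),
`1/(3(s − 1)) ≤ m_c/m_band − 1 ≤ 1/(2(s − 1))` with `s − 1 = γ(p − p₀)` — the mass diverges like
`1/(p − p₀)`. [cite: Erkenov2025KappaBEDTTTFMottThesis, §5.6 p. 71] -/
theorem brMassRatio_sub_one_bounds {γ p₀ p : ℝ} (h1 : 1 < sVar γ p₀ p) (h2 : sVar γ p₀ p ≤ 2) :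
    1 / (3 * (sVar γ p₀ p - 1)) ≤ brMassRatio γ p₀ p - 1 ∧
      brMassRatio γ p₀ p - 1 ≤ 1 / (2 * (sVar γ p₀ p - 1)) := by
  rw [brMassRatio_sub_one h1]
  set s := sVar γ p₀ p with hsdef
  have hpos : 0 < s - 1 := by linarith
  have hfac : s ^ 2 - 1 = (s - 1) * (s + 1) := by ring
  have hq : 0 < s ^ 2 - 1 := by rw [hfac]; positivity
  constructor
  · rw [div_le_div_iff₀ (by positivity) hq]; nlinarith
  · rw [div_le_div_iff₀ hq (by positivity)]; nlinarith

/-- **Antitone in `s` above the divergence**: a larger `s` (higher pressure, `γ > 0`) gives a smaller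
enhancement. [cite: Erkenov2025KappaBEDTTTFMottThesis, §5.6 Fig. 5.9 p. 72] -/
theorem brMassRatio_anti {γ p₀ p₁ p₂ : ℝ} (h1 : 1 < sVar γ p₀ p₁) (h12 : sVar γ p₀ p₁ ≤ sVar γ p₀ p₂) :
    brMassRatio γ p₀ p₂ ≤ brMassRatio γ p₀ p₁ := by
  have h2 : 1 < sVar γ p₀ p₂ := lt_of_lt_of_le h1 h12
  have e1 := brMassRatio_sub_one h1
  have e2 := brMassRatio_sub_one h2
  have q1 : 0 < sVar γ p₀ p₁ ^ 2 - 1 := by nlinarith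
  have q2 : sVar γ p₀ p₁ ^ 2 - 1 ≤ sVar γ p₀ p₂ ^ 2 - 1 := by nlinarith
  have : 1 / (sVar γ p₀ p₂ ^ 2 - 1) ≤ 1 / (sVar γ p₀ p₁ ^ 2 - 1) :=
    one_div_le_one_div_of_le q1 q2
  linarith

/-- With `γ > 0`, `s` is monotone in pressure, so the mass ratio is antitone in `p` above `p₀`.
[cite: Erkenov2025KappaBEDTTTFMottThesis, §5.6 Fig. 5.9 p. 72] -/
theorem brMassRatio_anti_pressure {γ p₀ p₁ p₂ : ℝ} (hγ : 0 < γ) (hp : p₀ < p₁) (h12 : p₁ ≤ p₂) :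
    brMassRatio γ p₀ p₂ ≤ brMassRatio γ p₀ p₁ := by
  apply brMassRatio_anti
  · simp only [sVar]; nlinarith
  · simp only [sVar]; nlinarith

/-- **Exactly twice the band mass at `s² = 2`**, i.e. at `p = p₀ + (√2 − 1)/γ`.
[cite: Erkenov2025KappaBEDTTTFMottThesis, §5.6 Eq. (5.2) p. 72] -/
theorem brMassRatio_eq_two_iff {γ p₀ p : ℝ} (hs : 1 < sVar γ p₀ p) :
    brMassRatio γ p₀ p = 2 ↔ sVar γ p₀ p ^ 2 = 2 := by
  have hs0 : sVar γ p₀ p ≠ 0 := by linarith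
  have h1 : sVar γ p₀ p ^ 2 - 1 ≠ 0 := by nlinarith
  rw [brMassRatio_eq_sq_div γ p₀ p hs0, div_eq_iff h1]
  constructor <;> intro h <;> linarith

/-- **Return to the band mass far from `p₀`**: `s ≥ 3 ⇒ m_c/m_band ≤ 9/8`.
[cite: Erkenov2025KappaBEDTTTFMottThesis, §5.6 p. 73] -/
theorem brMassRatio_le_of_three_le {γ p₀ p : ℝ} (hs : 3 ≤ sVar γ p₀ p) :
    brMassRatio γ p₀ p ≤ 9 / 8 := by
  have h1 : 1 < sVar γ p₀ p := by linarith
  have e := brMassRatio_sub_one h1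
  have q : 8 ≤ sVar γ p₀ p ^ 2 - 1 := by nlinarith
  have : 1 / (sVar γ p₀ p ^ 2 - 1) ≤ 1 / 8 := one_div_le_one_div_of_le (by norm_num) q
  linarith

/-! ## The printed fit parameters, evaluated exactly -/

/-- **κ-Cl β orbit at ambient pressure** (`γ = 0.77`, `p₀ = −0.28`): `s = 1.2156` and
`3.09 < m_c/m_band(0) < 3.10`. [cite: Erkenov2025KappaBEDTTTFMottThesis, Table 5.1 p. 72] -/
theorem kCl_ambient :
    sVar 0.77 (-0.28) 0 = 1.2156 ∧
      3.09 < brMassRatio 0.77 (-0.28) 0 ∧ brMassRatio 0.77 (-0.28) 0 < 3.10 := by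
  refine ⟨by norm_num [sVar], ?_, ?_⟩ <;> norm_num [brMassRatio]

/-- **κ-Cl at `1.5` GPa**: `1.21 < m_c/m_band < 1.22` («approaches the non-interacting band mass»).
[cite: Erkenov2025KappaBEDTTTFMottThesis, §5.6 p. 73] -/
theorem kCl_1p5GPa :
    1.21 < brMassRatio 0.77 (-0.28) 1.5 ∧ brMassRatio 0.77 (-0.28) 1.5 < 1.22 := by
  constructor <;> norm_num [brMassRatio]

/-- **κ-NCS β orbit at ambient** (`γ = 0.63`, `p₀ = −0.29`): `3.50 < m_c/m_band(0) < 3.51`; with the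
fitted band mass `1.9 m₀` this is `6.65–6.67 m₀` (cf. the located `m_β = 6.5(2) m₀`).
[cite: Erkenov2025KappaBEDTTTFMottThesis, Table 5.1 p. 72] -/
theorem kNCS_ambient :
    3.50 < brMassRatio 0.63 (-0.29) 0 ∧ brMassRatio 0.63 (-0.29) 0 < 3.51 ∧
      6.65 < 1.9 * brMassRatio 0.63 (-0.29) 0 ∧ 1.9 * brMassRatio 0.63 (-0.29) 0 < 6.67 := by
  refine ⟨?_, ?_, ?_, ?_⟩ <;> norm_num [brMassRatio]

/-- **κ-Br β orbit at ambient** (γ fixed `0.8`, `p₀ = −0.30`, `m_band = 2.2 m₀`): `2.86 < m_c/m_band(0) <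
2.87` and `6.29 < m_c(0) < 6.32 m₀` — the measured pulsed-field mass is `6.3 ± 0.1 m₀`.
[cite: Erkenov2025KappaBEDTTTFMottThesis, §7 p. 127; §6.6 p. 111] -/
theorem kBr_ambient :
    2.86 < brMassRatio 0.8 (-0.30) 0 ∧ brMassRatio 0.8 (-0.30) 0 < 2.87 ∧
      6.29 < 2.2 * brMassRatio 0.8 (-0.30) 0 ∧ 2.2 * brMassRatio 0.8 (-0.30) 0 < 6.32 := by
  refine ⟨?_, ?_, ?_, ?_⟩ <;> norm_num [brMassRatio]

/-- **κ-CN β orbit at `0.24` GPa** (`γ = 0.8`, `p₀ = −0.16`, `m_band = 2.8 m₀`): `2.34 < m_c/m_band < 2.35`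
and `6.5 < m_c < 6.6 m₀` — the measured `7.2 ± 0.1` at `θ ≈ 24°` times `cos θ`; at ambient the metallic
branch would read `4.67 < · < 4.68`. [cite: Erkenov2025KappaBEDTTTFMottThesis, §8.7 p. 142–144] -/
theorem kCN_images :
    2.34 < brMassRatio 0.8 (-0.16) 0.24 ∧ brMassRatio 0.8 (-0.16) 0.24 < 2.35 ∧
      6.5 < 2.8 * brMassRatio 0.8 (-0.16) 0.24 ∧ 2.8 * brMassRatio 0.8 (-0.16) 0.24 < 6.6 ∧
      4.67 < brMassRatio 0.8 (-0.16) 0 ∧ brMassRatio 0.8 (-0.16) 0 < 4.68 := by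
  refine ⟨?_, ?_, ?_, ?_, ?_, ?_⟩ <;> norm_num [brMassRatio]

/-- **The «chemical pressure» of κ-CN on the correlation axis**: its BR critical pressure lies
`0.12` GPa above κ-Cl's, `−0.16 − (−0.28) = 0.12`, while Cl/NCS/Br agree to `0.04` GPa.
[cite: Erkenov2025KappaBEDTTTFMottThesis, §8.7 p. 144; §8.8 p. 145] -/
theorem criticalPressure_offsets :
    (-0.16 : ℝ) - (-0.28) = 0.12 ∧ (-0.26 : ℝ) - (-0.30) = 0.04 ∧ |(-0.28 : ℝ) - (-0.29)| ≤ 0.04 := by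
  refine ⟨by norm_num, by norm_num, by norm_num [abs_le]⟩

/-- **Theory vs experiment on the pressure sensitivity `γ = dt/(t₀ dp)`**: `0.77/0.07 = 11` («an order of
magnitude», κ-NCS DFT) and `3.47 < 0.8/0.23 < 3.48` («three times», κ-CN DFT).
[cite: Erkenov2025KappaBEDTTTFMottThesis, §5.6 p. 73; §8.7 p. 144] -/
theorem gamma_theory_vs_experiment :
    (0.77 : ℝ) / 0.07 = 11 ∧ (3.47 : ℝ) < 0.8 / 0.23 ∧ (0.8 : ℝ) / 0.23 < 3.48 := by
  refine ⟨by norm_num, by norm_num, by norm_num⟩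

/-- **One `γ` for all four salts within the printed bars**: the intervals `0.77 ± 0.11`, `0.63 ± 0.28`,
`1.1 ± 0.3` and `0.8 ± 0.2` GPa⁻¹ all contain `0.8`. [cite: Erkenov2025KappaBEDTTTFMottThesis, §8.7 p. 144] -/
theorem gamma_common_value :
    |(0.8 : ℝ) - 0.77| ≤ 0.11 ∧ |(0.8 : ℝ) - 0.63| ≤ 0.28 ∧ |(0.8 : ℝ) - 1.1| ≤ 0.3 ∧ |(0.8 : ℝ) - 0.8| ≤ 0.2 := by
  refine ⟨?_, ?_, ?_, ?_⟩ <;> norm_num [abs_le]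

/-- **Hopping change over the measured range**: with `γ = 0.8 GPa⁻¹`, `1.5` GPa raises `t` by `120 %` of `t₀`
and `0.3` GPa by `24 %` — the located size of the P-axis one-body lever for the κ boxes.
[cite: Erkenov2025KappaBEDTTTFMottThesis, §5.6 p. 73] -/
theorem hopping_lever (t₀ p₀ : ℝ) (ht : t₀ ≠ 0) :
    (hopping t₀ 0.8 p₀ (p₀ + 1.5) - hopping t₀ 0.8 p₀ p₀) / t₀ = 1.2 ∧
      (hopping t₀ 0.8 p₀ (p₀ + 0.3) - hopping t₀ 0.8 p₀ p₀) / t₀ = 0.24 := by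
  rw [hopping_rel_change _ _ _ _ _ ht, hopping_rel_change _ _ _ _ _ ht]
  constructor <;> ring

end Literature.MathematicalPhysics.QuantumLattice.BrinkmanRicePressure
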